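import Summits.AtomisticToContinuum.Crystallization.Theorems.ThreeConeCertificateSlackRigidityPricedFloorsDefs
import Literature.Probability.Process.RootedHardCoreVague
import Mathlib
import HarnessLib

/-!
# `SlackRigidity` (stmt-AtomisticToContinuum-11960), line `priced-floors-palm-exactification`:
# the counting-measure map of rooted hard-core configurations is a measurable embedding

Stub `stub_toMeasureEmbedding` (S3 infrastructure, measurability transfer).  For `δ > 0` the map
`S ↦ count|S` from the compact metric space `LocalConfig.RootedHardCoreConfig E3 δ` of rooted
`δ`-hard-core configurations of `ℝ³` (local rubber topology) to `Measure E3` (Giry σ-algebra) is a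
`MeasurableEmbedding`.  Ingredients:

* measurability is `LocalConfig.measurable_toMeasure`, injectivity is
  `LocalConfig.toMeasure_injective`;
* the domain is a compact metric space, hence standard Borel;
* the codomain `Measure E3` is not countably separated, but the measurable set of measures that
  are finite on every ball `B̄(0, n)` is (`hasCountableSeparatingOn_ballFinite`): such measures
  are locally finite, hence outer regular, hence determined by their values on open sets
  (`Measure.OuterRegular.ext_isOpen`), hence by their values on the countably many finite unions
  of a countable topological basis (continuity from below along `Set.accumulate`), and a value in
  `ℝ≥0∞` is determined by its comparisons with the rationals;
* Lusin–Souslin (`Measurable.measurableEmbedding`) for the codomain-restricted map, composed with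
  the embedding of the measurable subtype (`MeasurableEmbedding.subtype_coe`).

All `[folklore]`.
-/

noncomputable section

open MeasureTheory Set Filter Topology
open scoped ENNReal

namespace Summit.AtomisticToContinuum.Crystallization.Theorems.SlackRigidityPricedFloorsEmbedding

open Literature.Probability.Process
open Summit.AtomisticToContinuum.Crystallization.Theorems.SlackRigidityPricedFloors
open TopologicalSpace

/-! ## Values in `ℝ≥0∞` are determined by rational comparisons -/

/-- Two extended nonnegative reals with the same strict rational upper bounds are equal.
[folklore] -/
theorem ennreal_eq_of_forall_rat_iff {a b : ℝ≥0∞}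
    (h : ∀ q : ℚ, a < (Real.toNNReal q : ℝ≥0∞) ↔ b < (Real.toNNReal q : ℝ≥0∞)) : a = b := by
  rcases lt_trichotomy a b with hab | rfl | hab
  · obtain ⟨q, -, haq, hqb⟩ := ENNReal.lt_iff_exists_rat_btwn.1 hab
    exact absurd ((h q).1 haq) (not_lt.2 hqb.le)
  · rfl
  · obtain ⟨q, -, hbq, hqa⟩ := ENNReal.lt_iff_exists_rat_btwn.1 hab
    exact absurd ((h q).2 hbq) (not_lt.2 hqa.le)

/-! ## Measures agreeing on finite unions of a basis agree on open sets -/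

/-- If two measures agree on every finite union of members of a topological basis `b` of a
second-countable space (more precisely: on `⋃₀ F` for every finite `F ⊆ b` with `b` countable), they
agree on every open set (continuity from below along the partial unions of an enumeration).
[folklore] -/
theorem measure_open_eq_of_eq_on_finite_sUnion {X : Type*} [TopologicalSpace X]
    [MeasurableSpace X] {b : Set (Set X)} (hb : IsTopologicalBasis b) (hbc : b.Countable)
    {μ ν : Measure X}
    (h : ∀ F : Set (Set X), F.Finite → F ⊆ b → μ (⋃₀ F) = ν (⋃₀ F))
    {U : Set X} (hU : IsOpen U) : μ U = ν U := by
  obtain ⟨S, hSb, rfl⟩ := hb.open_eq_sUnion hU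
  rcases S.eq_empty_or_nonempty with rfl | hSne
  · simp
  obtain ⟨g, rfl⟩ := (hbc.mono hSb).exists_eq_range hSne
  rw [sUnion_range, measure_iUnion_eq_iSup_accumulate, measure_iUnion_eq_iSup_accumulate]
  refine iSup_congr fun n => ?_
  have hacc : Set.accumulate g n = ⋃₀ (g '' Iic n) := by
    rw [Set.accumulate_def, sUnion_image]
    rfl
  rw [hacc]
  exact h _ ((finite_Iic n).image g) (by
    rintro _ ⟨k, -, rfl⟩
    exact hSb (mem_range_self k))

/-! ## The ball-finite measures form a countably separated measurable set -/

/-- A measure on `ℝ³` finite on every ball `B̄(0, n)` is locally finite. [folklore] -/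
theorem isLocallyFiniteMeasure_of_ballFinite {μ : Measure E3}
    (hμ : ∀ n : ℕ, μ (Metric.closedBall (0 : E3) n) < ∞) : IsLocallyFiniteMeasure μ := by
  refine ⟨fun x => ?_⟩
  obtain ⟨n, hn⟩ := exists_nat_gt ‖x‖
  refine ⟨Metric.closedBall (0 : E3) n, ?_, hμ n⟩
  exact mem_of_superset (Metric.isOpen_ball.mem_nhds (mem_ball_zero_iff.2 hn))
    Metric.ball_subset_closedBall

/-- The set of measures on `ℝ³` finite on every ball `B̄(0, n)` is measurable for the Giry
σ-algebra. [folklore] -/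
theorem measurableSet_ballFinite :
    MeasurableSet {μ : Measure E3 | ∀ n : ℕ, μ (Metric.closedBall (0 : E3) n) < ∞} := by
  have : {μ : Measure E3 | ∀ n : ℕ, μ (Metric.closedBall (0 : E3) n) < ∞} =
      ⋂ n : ℕ, (fun μ : Measure E3 => μ (Metric.closedBall (0 : E3) n)) ⁻¹' Iio ∞ := by
    ext μ
    simp only [mem_setOf_eq, mem_iInter, mem_preimage, mem_Iio]
  rw [this]
  exact MeasurableSet.iInter fun n =>
    Measure.measurable_coe Metric.isClosed_closedBall.measurableSet measurableSet_Iio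

/-- **The ball-finite measures on `ℝ³` are countably separated** by the measurable sets
`{μ | μ D < q}`, `D` a finite union of members of a countable topological basis, `q ∈ ℚ`: two such
measures lying in the same sets of the family agree on all finite unions of basic open sets, hence on
all open sets, hence (outer regularity of locally finite measures) everywhere. [folklore] -/
theorem hasCountableSeparatingOn_ballFinite :
    HasCountableSeparatingOn (Measure E3) MeasurableSet
      {μ : Measure E3 | ∀ n : ℕ, μ (Metric.closedBall (0 : E3) n) < ∞} := by
  classical
  set b : Set (Set E3) := countableBasis E3 with hb_def
  have hb : IsTopologicalBasis b := isBasis_countableBasis E3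
  have hbc : b.Countable := countable_countableBasis E3
  -- finite unions of basic open sets
  set D : Set (Set E3) := (fun F : Set (Set E3) => ⋃₀ F) '' {F | F.Finite ∧ F ⊆ b} with hD_def
  have hDc : D.Countable := (Set.countable_setOf_finite_subset hbc).image _
  have hDo : ∀ d ∈ D, IsOpen d := by
    rintro _ ⟨F, ⟨-, hF⟩, rfl⟩
    exact isOpen_sUnion fun s hs => hb.isOpen (hF hs)
  -- the separating family
  set fam : Set (Set (Measure E3)) :=
    (fun p : Set E3 × ℚ => {μ : Measure E3 | μ p.1 < (Real.toNNReal (p.2 : ℝ) : ℝ≥0∞)}) ''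
      (D ×ˢ (univ : Set ℚ)) with hfam_def
  refine ⟨⟨fam, (hDc.prod (countable_univ (α := ℚ))).image _, ?_, ?_⟩⟩
  · rintro _ ⟨⟨d, q⟩, ⟨hd, -⟩, rfl⟩
    exact Measure.measurable_coe (hDo d hd).measurableSet measurableSet_Iio
  · intro μ hμ ν hν hsep
    -- agreement on finite unions of basic sets
    have hD : ∀ d ∈ D, μ d = ν d := fun d hd =>
      ennreal_eq_of_forall_rat_iff fun q => hsep _ ⟨(d, q), ⟨hd, mem_univ _⟩, rfl⟩
    -- agreement on open sets
    have hO : ∀ U : Set E3, IsOpen U → μ U = ν U := fun U hU =>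
      measure_open_eq_of_eq_on_finite_sUnion hb hbc
        (fun F hF hFb => hD _ ⟨F, ⟨hF, hFb⟩, rfl⟩) hU
    -- outer regularity
    haveI := isLocallyFiniteMeasure_of_ballFinite hμ
    haveI := isLocallyFiniteMeasure_of_ballFinite hν
    exact Measure.OuterRegular.ext_isOpen hO

/-! ## The stub -/

/-- The counting measure of a rooted `δ`-hard-core configuration (`δ > 0`) is finite on every
ball `B̄(0, n)` (separated sets meet compact sets finitely). [folklore] -/
theorem toMeasure_ballFinite {δ : ℝ} (hδ : 0 < δ) (S : LocalConfig.RootedHardCoreConfig E3 δ)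
    (n : ℕ) : (S.1 : LocalConfig E3).toMeasure (Metric.closedBall (0 : E3) n) < ∞ := by
  rw [LocalConfig.toMeasure_def, Measure.restrict_apply Metric.isClosed_closedBall.measurableSet]
  exact Measure.count_apply_lt_top.2
    (LocalConfig.finite_inter_of_separated hδ S.2.2 (isCompact_closedBall _ _))

/-- **Stub `stub_toMeasureEmbedding` (S3 measurability transfer).**  For `δ > 0`, the
counting-measure map `S ↦ count|S` from the compact metric space of rooted `δ`-hard-core
configurations of `ℝ³` (local rubber topology) to `Measure E3` with the Giry σ-algebra is a
measurable embedding: it is measurable (`LocalConfig.measurable_toMeasure`) and injective, the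
domain is standard Borel, and its range lies in the countably separated measurable set of
ball-finite measures, so Lusin–Souslin (`Measurable.measurableEmbedding`) applies to the
codomain-restricted map. Consequently Borel functionals of the rooted configuration extend to
Giry-measurable functionals of the counting measure (`MeasurableEmbedding.measurable_extend`).
[folklore] -/
theorem stub_toMeasureEmbedding : ∀ (δ : ℝ) [Fact (0 < δ)], MeasurableEmbedding (fun S : LocalConfig.RootedHardCoreConfig E3 δ => (S.1 : LocalConfig E3).toMeasure) := by
  intro δ hδ
  have hM := measurableSet_ballFinite
  haveI := hasCountableSeparatingOn_ballFinite
  have hg : MeasurableEmbedding fun S : LocalConfig.RootedHardCoreConfig E3 δ =>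
      (⟨(S.1 : LocalConfig E3).toMeasure, toMeasure_ballFinite hδ.out S⟩ :
        {μ : Measure E3 | ∀ n : ℕ, μ (Metric.closedBall (0 : E3) n) < ∞}) :=
    (LocalConfig.measurable_toMeasure hδ.out).subtype_mk.measurableEmbedding fun S T hST =>
      Subtype.ext (LocalConfig.toMeasure_injective (congrArg Subtype.val hST))
  exact (MeasurableEmbedding.subtype_coe hM).comp hg

end Summit.AtomisticToContinuum.Crystallization.Theorems.SlackRigidityPricedFloorsEmbedding
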